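import Summits.HodgeConjecture.HodgeCM.PerL34.S5QautSeesawArch_1

/-! PORT of `HodgeCM/PerL34/S5QautSeesawArch.lean` (HodgeCMPerL run 82) — part 2: continuation of `Summits.HodgeConjecture.HodgeCM.PerL34.S5QautSeesawArch_1` (split at a top-level declaration boundary by port_pkg.py; scope re-opened below; declarations unchanged). -/

-- port_pkg: scope re-opened for this part (file-level context, then the namespace/section stack open at the cut)
set_option autoImplicit false
noncomputable section
open MeasureTheory Matrix MvPolynomial
open HodgeCM.Prior.Perl34File
open HodgeCM.PerL34.Qaut (pr prL prL_apply wedge)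
open HodgeCM.PerL34.P43KTypesU2 (Jplus Jplus_apply_coe fockRep fockRep_apply jplusSubmodule mem_jplusSubmodule
  isWeightedHomogeneous_substHom)
open HodgeCM.PerL34.QautFock (pPlusMat continuous_pPlusMat isUnit_det_pPlusMat formOf QautFockBridge
  N19g_core_of_fockBridge open_thetaReal34_of_fockBridges)
open HodgeCM.PerL34.Seesaw
open HodgeCM.PerL34.QautSeesaw (QautSeesawBridge thetaPeriod_sum_tmul N19g_core_of_seesawBridge
  open_thetaReal34_of_seesawBridges)
namespace HodgeCM
namespace PerL34
namespace QautSeesawArch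
variable {U : Universe} (T : U.ThetaModel)
variable {L : CMField} {ι₁ : L →+* ℂ} (V : HermSpace3 L ι₁) (c : SeesawCtx L)
variable (D : Perl34.TorusData (T.core V c)) (k l : Fin 4)
/-- **The S5 bridge record, `N19g` half, widened to pure tensors of ALL pure archimedean types** (adv2g12-O4 (ii)).
Compared with F3's `QautSeesaw.QautSeesawBridge`: `Adm_j`, `emb_j`, `thetaJ_j` are GONE (defined in §4 — admissible :=
vacuum weight at every real place away from `ι₁`; `emb_j`, `thetaJ_j` := restriction of `embH_j`, `thetaH_j` to `J⁺`);
NEW are the whole-Fock-factor data `embH_j`, `thetaH_j`, the pure-type bookkeeping `Pl`, `e_j`, `kW_j`, `wt_j`, and the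
archimedean circles with their three structural properties (period invariance, type of `χ′_j`, covariance of `ω_j`);
`ϑ_pr` lost the admissibility clause and the sentence ll. 362–364 from its label.  See the module docstring for the label
of every field. -/
structure QautSeesawArchBridge where
  /-- SHELL (D5): `K_∞` -/
  K : Type
  [instK₁ : Group K]
  [instK₂ : TopologicalSpace K]
  [instK₃ : IsTopologicalGroup K]
  [instK₄ : MeasurableSpace K]
  [instK₅ : BorelSpace K]
  [instK₆ : CompactSpace K]
  /-- its Haar probability measure -/
  μ : Measure K
  [instμ₁ : IsProbabilityMeasure μ]
  [instμ₂ : μ.IsMulLeftInvariant]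
  [instμ₃ : μ.IsMulRightInvariant]
  /-- SHELL (D5): the commutative Banach algebra of bounded right-uniformly continuous functions on `G_U(L₀)\G_U(𝔸)` -/
  C : Type
  [instC₁ : NormedCommRing C]
  [instC₂ : NormedAlgebra ℂ C]
  [instC₃ : CompleteSpace C]
  /-- right translation by `K_∞` (algebra automorphisms), strongly continuous -/
  σ : K →* (C →ₐ[ℂ] C)
  σ_cont : ∀ f : C, Continuous fun x => σ x f
  /-- DICTIONARY (D2): the projection `K_∞ → K_{ι₁} = U(2) × U(1)` -/
  κ : K →* P43KTypesU2.K
  κ_cont : Continuous κ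
  /-- DICTIONARY (D2): a torus element with distinct `𝔭₊`-weights and a Weyl element lie in the image -/
  ρ_diag : ∃ x s t, s ≠ t ∧ pPlusMat (κ x) = !![s, 0; 0, t]
  ρ_antidiag : ∃ x a b, pPlusMat (κ x) = !![0, a; b, 0]
  /-- the central `U(1)_V`: `κ k₀ = (1₂, d₀)`, `d₀` of infinite order -/
  k₀ : K
  d₀ : unitary ℂ
  κ_k₀ : κ k₀ = P43KTypesU2.diagK 1 1 d₀
  d₀_pow_ne_one : ∀ m : ℕ, 1 ≤ m → (d₀ : ℂ) ^ m ≠ 1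
  /-- DICTIONARY (D5): the `L²` class of a function of the shell -/
  toHG : C →ₗ[ℂ] T.HG L ι₁ V
  /-- SETUP (D4′): pv11's lattice shell for the pair of lines of the side -/
  DS : ThetaSeesawData
  [instS : AddCommGroup DS.S]
  [instA₁ : MeasurableSpace DS.A₁]
  [instA₂ : MeasurableSpace DS.A₂]
  /-- Haar probability measures of `[U(W_j)]` -/
  ν₁ : Measure DS.A₁
  ν₂ : Measure DS.A₂
  [sf₁ : SFinite ν₁]
  [sf₂ : SFinite ν₂]
  /-- N17 hypotheses, exactly as in F3 -/
  omegaSub : DS.OmegaSub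
  evSub : DS.EvSub
  evalTmul : DS.EvalTmul
  restrictTmul : DS.RestrictTmul
  absSummable₁ : DS.AbsSummable₁
  absSummable₂ : DS.AbsSummable₂
  /-- STRUCTURAL (D5): `C` is an algebra of functions on `G_U(𝔸)` -/
  evalC : C →ₐ[ℂ] (DS.G → ℂ)
  evalC_injective : Function.Injective evalC
  /-- STRUCTURAL (D5): `σ` IS right translation by `K_∞ ⊂ G_U(𝔸)` -/
  ract : K → DS.G → DS.G
  evalC_sigma : ∀ (x : K) (f : C) (g : DS.G), evalC (σ x f) g = evalC f (ract x g)
  /-- STRUCTURAL (D4): `ω_j(x) := ω_j(x, 1)` for `x ∈ K_∞`; `ω_j(g·x, u) = ω_j(g, u) ∘ ω_j(x)` -/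
  ωK₁ : K → DS.S₁ → DS.S₁
  ωK₂ : K → DS.S₂ → DS.S₂
  omega_ract₁ : ∀ (x : K) (g : DS.G) (u : DS.A₁) (φ : DS.S₁), DS.ω₁ (ract x g) u φ = DS.ω₁ g u (ωK₁ x φ)
  omega_ract₂ : ∀ (x : K) (g : DS.G) (u : DS.A₂) (φ : DS.S₂), DS.ω₂ (ract x g) u φ = DS.ω₂ g u (ωK₂ x φ)
  /-- DICTIONARY (D1): the two components `χ′_j` of `χ = χ′₁ ⊠ χ′₂ ∈ D.X` -/
  ch₁ : D.X → (DS.A₁ → ℂ)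
  ch₂ : D.X → (DS.A₂ → ℂ)
  /-- SETUP: the real places `b ≠ ι₁` of `L₀` (an index type; nothing is assumed about it) -/
  Pl : Type
  /-- ll. 474–476: `e_b(Ψ_j)`, `b ≠ ι₁` — `U(W_{j,b}) = U(1)` acts on the vacuum line of `𝓕_{j,b}` by `u ↦ u^{-e_b}`
  (this DEFINES `e_b`) -/
  e₁ : Pl → ℤ
  e₂ : Pl → ℤ
  /-- STRUCTURAL (D4, [Adams07 §2] / pv12 (F2)): the vacuum twist of the Fock model at `ι₁` — `U(W_{j,ι₁}) = U(1)` acts on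
  `𝓕_{j,ι₁} = ℂ[z₁,z₂,w]` by pv02-g4's `Fock.harmCircle kW_j` -/
  kW₁ : ℤ
  kW₂ : ℤ
  /-- D1/D4: the Schwartz data AWAY from `ι₁`: pure tensors of PURE `U(W_{j,b})`-types at every real `b ≠ ι₁` (times
  finite data), with their weights -/
  Away₁ : Type
  Away₂ : Type
  wt₁ : Pl → Away₁ → ℤ
  wt₂ : Pl → Away₂ → ℤ
  /-- DICTIONARY (D5, the Fock sentence) for the WHOLE Fock factor: `p ⊗ a ∈ 𝒮((V₃⊗W_j)(𝔸))`, `p ∈ ℂ[z₁,z₂,w]` -/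
  embH₁ : Away₁ → Fock.HarmModel → DS.S₁
  embH₂ : Away₂ → Fock.HarmModel → DS.S₂
  /-- DICTIONARY (D5): `K_∞ = K_{ι₁} × ∏_{b ≠ ι₁} U(3)` acts on `p ⊗ a`, `a` of vacuum type at every `b ≠ ι₁` (the vacuum
  line is the `𝟏_{U(3)}`-isotypic line, ll. 474–476), through `K_{ι₁}` on the Fock factor (pv14's `fockRep`) -/
  emb_equiv₁ : ∀ a, (∀ b, wt₁ b a = -e₁ b) → ∀ (x : K) (p : Fock.HarmModel), ωK₁ x (embH₁ a p) = embH₁ a (fockRep (κ x) p)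
  emb_equiv₂ : ∀ a, (∀ b, wt₂ b a = -e₂ b) → ∀ (x : K) (p : Fock.HarmModel), ωK₂ x (embH₂ a p) = embH₂ a (fockRep (κ x) p)
  /-- PerL l. 335 ("all integrals over compact sets of continuous functions"): `u ↦ θ_{p⊗a}(g,u) χ′_j(u)` is integrable on
  `[U(W_j)]` for EVERY Fock polynomial `p` -/
  integrable₁ : ∀ χ a (p : Fock.HarmModel) (g : DS.G), Integrable (fun u => DS.thetaKernel₁ (embH₁ a p) g u * ch₁ χ u) ν₁
  integrable₂ : ∀ χ a (p : Fock.HarmModel) (g : DS.G), Integrable (fun u => DS.thetaKernel₂ (embH₂ a p) g u * ch₂ χ u) ν₂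
  /-- DEFINITIONAL (D4): the theta map `p ↦ θ(p ⊗ a, χ′_j)` on the whole Fock factor, as an element of `C` — it IS pv11's
  `thetaLift_j` -/
  thetaH₁ : D.X → Away₁ → (Fock.HarmModel →ₗ[ℂ] C)
  thetaH₂ : D.X → Away₂ → (Fock.HarmModel →ₗ[ℂ] C)
  evalC_thetaH₁ : ∀ χ a (p : Fock.HarmModel), evalC (thetaH₁ χ a p) = DS.thetaLift₁ ν₁ (ch₁ χ) (embH₁ a p)
  evalC_thetaH₂ : ∀ χ a (p : Fock.HarmModel), evalC (thetaH₂ χ a p) = DS.thetaLift₂ ν₂ (ch₂ χ) (embH₂ a p)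
  /-- DEFINITIONAL (D4): the torus period `ϑ_{T′,χ}(Φ′)` of a shell vector as an element of `C` — pv11's `thetaPeriod` -/
  periodC : D.X → DS.S → C
  evalC_periodC : ∀ χ (Φ' : DS.S), evalC (periodC χ Φ') = DS.thetaPeriod ν₁ ν₂ (ch₁ χ) (ch₂ χ) Φ'
  /-- STRUCTURAL (D4′): translation of `U(W_j)(𝔸)` by the archimedean circle `U(W_j)(L₀ ⊗_b ℝ) = U(1)`, at `b = ι₁`
  (`rι_j`) and at `b ≠ ι₁` (`r_j b`) -/
  rι₁ : Circle → DS.A₁ → DS.A₁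
  rι₂ : Circle → DS.A₂ → DS.A₂
  r₁ : Pl → Circle → DS.A₁ → DS.A₁
  r₂ : Pl → Circle → DS.A₂ → DS.A₂
  /-- STRUCTURAL: the period integral over `[U(W_j)]` is invariant under these translations (Haar measure of the
  automorphic quotient; `u ↦ θ_φ(g,u) χ′_j(u)` is a function on the quotient).  Sufficient: `§1
  integral_comp_eq_of_measurePreserving` when `A_j` models the quotient. -/
  period_rι₁ : ∀ (z : Circle) (φ : DS.S₁) (g : DS.G) (χ : D.X),
    ∫ u, DS.thetaKernel₁ φ g (rι₁ z u) * ch₁ χ (rι₁ z u) ∂ν₁ = ∫ u, DS.thetaKernel₁ φ g u * ch₁ χ u ∂ν₁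
  period_rι₂ : ∀ (z : Circle) (φ : DS.S₂) (g : DS.G) (χ : D.X),
    ∫ u, DS.thetaKernel₂ φ g (rι₂ z u) * ch₂ χ (rι₂ z u) ∂ν₂ = ∫ u, DS.thetaKernel₂ φ g u * ch₂ χ u ∂ν₂
  period_r₁ : ∀ (b : Pl) (z : Circle) (φ : DS.S₁) (g : DS.G) (χ : D.X),
    ∫ u, DS.thetaKernel₁ φ g (r₁ b z u) * ch₁ χ (r₁ b z u) ∂ν₁ = ∫ u, DS.thetaKernel₁ φ g u * ch₁ χ u ∂ν₁
  period_r₂ : ∀ (b : Pl) (z : Circle) (φ : DS.S₂) (g : DS.G) (χ : D.X),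
    ∫ u, DS.thetaKernel₂ φ g (r₂ b z u) * ch₂ χ (r₂ b z u) ∂ν₂ = ∫ u, DS.thetaKernel₂ φ g u * ch₂ χ u ∂ν₂
  /-- DICTIONARY (D1 + ll. 425–427 "automorphic characters of the forced archimedean types" + ll. 474–476): for an allowed
  `χ` the component `χ′_j` has archimedean type `e_b(Ψ_j)` at every real `b`; at `ι₁`, `e_{ι₁} = -(1 + kW_j)` since `J⁺ = F_1`
  is the weight-`(1 + kW_j)` space of `harmCircle kW_j` (pv02-g4 `Fock.weightSpace_harmCircle_one_add`) -/
  ch_rι₁ : ∀ χ, D.allowed χ → ∀ (z : Circle) (u : DS.A₁), ch₁ χ (rι₁ z u) = ch₁ χ u * (z : ℂ) ^ (-(1 + kW₁))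
  ch_rι₂ : ∀ χ, D.allowed χ → ∀ (z : Circle) (u : DS.A₂), ch₂ χ (rι₂ z u) = ch₂ χ u * (z : ℂ) ^ (-(1 + kW₂))
  ch_r₁ : ∀ χ, D.allowed χ → ∀ (b : Pl) (z : Circle) (u : DS.A₁), ch₁ χ (r₁ b z u) = ch₁ χ u * (z : ℂ) ^ e₁ b
  ch_r₂ : ∀ χ, D.allowed χ → ∀ (b : Pl) (z : Circle) (u : DS.A₂), ch₂ χ (r₂ b z u) = ch₂ χ u * (z : ℂ) ^ e₂ b
  /-- STRUCTURAL (D4): `ω_j` is a representation of `G_U × U(W_j)(𝔸)`; its archimedean circle acts on `p ⊗ a` at `ι₁` by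
  `harmCircle kW_j` on `p` and at `b ≠ ι₁` by the weight of the pure type `a` -/
  omega_rι₁ : ∀ (z : Circle) (g : DS.G) (u : DS.A₁) (a : Away₁) (p : Fock.HarmModel),
    DS.ω₁ g (rι₁ z u) (embH₁ a p) = DS.ω₁ g u (embH₁ a (Fock.harmCircle kW₁ z p))
  omega_rι₂ : ∀ (z : Circle) (g : DS.G) (u : DS.A₂) (a : Away₂) (p : Fock.HarmModel),
    DS.ω₂ g (rι₂ z u) (embH₂ a p) = DS.ω₂ g u (embH₂ a (Fock.harmCircle kW₂ z p))
  omega_r₁ : ∀ (b : Pl) (z : Circle) (g : DS.G) (u : DS.A₁) (a : Away₁) (p : Fock.HarmModel),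
    DS.ω₁ g (r₁ b z u) (embH₁ a p) = DS.ω₁ g u (embH₁ a (((z : ℂ) ^ wt₁ b a) • p))
  omega_r₂ : ∀ (b : Pl) (z : Circle) (g : DS.G) (u : DS.A₂) (a : Away₂) (p : Fock.HarmModel),
    DS.ω₂ g (r₂ b z u) (embH₂ a p) = DS.ω₂ g u (embH₂ a (((z : ℂ) ^ wt₂ b a) • p))
  /-- DICTIONARY (D2 + (Qaut) §3.1 + Lemma 3.3(a); ll. 371–372): the wedge of the canonical theta one-forms of an allowed
  character (vacuum type away from `ι₁`) is a `(k,l)`-wedge-function of the model -/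
  wedge_mem : ∀ χ, D.allowed χ → ∀ a₁, (∀ b, wt₁ b a₁ = -e₁ b) → ∀ a₂, (∀ b, wt₂ b a₂ = -e₂ b) →
    toHG (wedge (formOf ((thetaH₁ χ a₁).comp jplusSubmodule.subtype))
      (formOf ((thetaH₂ χ a₂).comp jplusSubmodule.subtype))) ∈ T.wedgeSet V c k l
  /-- D4 + PRINT (density of `K`-finite vectors): the dense subspace `P = pr_κ(𝒫) ⊆ 𝒮^κ` -/
  P : Set (T.SK V c)
  dense : Dense P
  /-- DICTIONARY (D4/D5 + l. 372 ONLY): `Φ ∈ P = pr_κ(𝒫)`, `𝒫 = 𝒫₁ ⊗ 𝒫₂` (Lemma 3.4, ll. 359–360; pv12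
  `Fock.pairMap_bijective`), so `Φ = pr_κ Φ′` with `Φ′ = Σ_i (p₁ⁱ⊗a₁ⁱ) ⊗ (p₂ⁱ⊗a₂ⁱ)` a finite sum of pure tensors of pure
  types — `p_jⁱ` ARBITRARY Fock polynomials at `ι₁`, `a_jⁱ` of ARBITRARY pure types away from `ι₁`; and
  `D.ϑ χ Φ = ϑ_{T,χ}(pr_κ Φ′) = pr_κ ϑ_{T,χ}(Φ′)` (l. 372).  NO statement about which types survive. -/
  ϑ_pr : ∀ χ, D.allowed χ → ∀ Φ ∈ P, ∃ (n : ℕ) (a₁ : Fin n → Away₁) (a₂ : Fin n → Away₂)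
    (p₁ p₂ : Fin n → Fock.HarmModel),
      D.ϑ χ Φ = toHG (pr μ (pPlusMat.comp κ) σ
        (periodC χ (∑ i, DS.tmul (embH₁ (a₁ i) (p₁ i)) (embH₂ (a₂ i) (p₂ i)))))

attribute [instance] QautSeesawArchBridge.instK₁ QautSeesawArchBridge.instK₂ QautSeesawArchBridge.instK₃
  QautSeesawArchBridge.instK₄ QautSeesawArchBridge.instK₅ QautSeesawArchBridge.instK₆ QautSeesawArchBridge.instμ₁
  QautSeesawArchBridge.instμ₂ QautSeesawArchBridge.instμ₃ QautSeesawArchBridge.instC₁ QautSeesawArchBridge.instC₂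
  QautSeesawArchBridge.instC₃ QautSeesawArchBridge.instS QautSeesawArchBridge.instA₁ QautSeesawArchBridge.instA₂
  QautSeesawArchBridge.sf₁ QautSeesawArchBridge.sf₂

/-! ## §4. The derived fields: vanishing of the off-type lifts (ll. 362–364 KERNEL) and the constructor -/

namespace QautSeesawArchBridge

variable {T V c D k l}
variable (R : QautSeesawArchBridge T V c D k l)

/-- ADMISSIBLE, DEFINED: vacuum `U(W_{j,b})`-weight at every real place `b ≠ ι₁`. -/
def Adm₁ (a : R.Away₁) : Prop := ∀ b, R.wt₁ b a = -R.e₁ b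

/-- see `Adm₁` -/
def Adm₂ (a : R.Away₂) : Prop := ∀ b, R.wt₂ b a = -R.e₂ b

/-- the theta map restricted to `J⁺` (F3's `thetaJ_j`) -/
def thetaJ₁ (χ : D.X) (a : R.Away₁) : jplusSubmodule →ₗ[ℂ] R.C := (R.thetaH₁ χ a).comp jplusSubmodule.subtype

/-- see `thetaJ₁` -/
def thetaJ₂ (χ : D.X) (a : R.Away₂) : jplusSubmodule →ₗ[ℂ] R.C := (R.thetaH₂ χ a).comp jplusSubmodule.subtype

/-- (Ported verbatim from the HodgeCMPerL package; no docstring in the source.) -/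
theorem thetaJ₁_apply (χ : D.X) (a : R.Away₁) (p : jplusSubmodule) : R.thetaJ₁ χ a p = R.thetaH₁ χ a p := rfl

/-- (Ported verbatim from the HodgeCMPerL package; no docstring in the source.) -/
theorem thetaJ₂_apply (χ : D.X) (a : R.Away₂) (p : jplusSubmodule) : R.thetaJ₂ χ a p = R.thetaH₂ χ a p := rfl

/-- KERNEL: the theta lift is linear in the Fock factor (scalars). -/
theorem thetaLift₁_embH_smul (χ : D.X) (a : R.Away₁) (s : ℂ) (p : Fock.HarmModel) (g : R.DS.G) :
    R.DS.thetaLift₁ R.ν₁ (R.ch₁ χ) (R.embH₁ a (s • p)) g = s * R.DS.thetaLift₁ R.ν₁ (R.ch₁ χ) (R.embH₁ a p) g := by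
  rw [← R.evalC_thetaH₁, ← R.evalC_thetaH₁, map_smul, map_smul, Pi.smul_apply, smul_eq_mul]

/-- (Ported verbatim from the HodgeCMPerL package; no docstring in the source.) -/
theorem thetaLift₂_embH_smul (χ : D.X) (a : R.Away₂) (s : ℂ) (p : Fock.HarmModel) (g : R.DS.G) :
    R.DS.thetaLift₂ R.ν₂ (R.ch₂ χ) (R.embH₂ a (s • p)) g = s * R.DS.thetaLift₂ R.ν₂ (R.ch₂ χ) (R.embH₂ a p) g := by
  rw [← R.evalC_thetaH₂, ← R.evalC_thetaH₂, map_smul, map_smul, Pi.smul_apply, smul_eq_mul]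

/-- **ll. 362–364 at `ι₁`, KERNEL:** a Fock polynomial in `F_{k'}`, `k' ≠ 1` (a `K_{ι₁}`-type NOT occurring in `J⁺ = F_1`),
lifts to `0` against every allowed character. -/
theorem thetaLift₁_eq_zero_of_mem_hpiece (χ : D.X) (hχ : D.allowed χ) (a : R.Away₁) {k' : ℤ} {p : Fock.HarmModel}
    (hp : p ∈ Fock.hpiece k') (hk' : k' ≠ 1) (g : R.DS.G) :
    R.DS.thetaLift₁ R.ν₁ (R.ch₁ χ) (R.embH₁ a p) g = 0 :=
  thetaLift₁_eq_zero_of_weight R.DS R.ν₁ (R.ch₁ χ) R.rι₁ (-(1 + R.kW₁)) (k' + R.kW₁) (R.embH₁ a p)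
    (fun z => R.embH₁ a (Fock.harmCircle R.kW₁ z p)) g (fun z => R.period_rι₁ z _ g χ) (R.ch_rι₁ χ hχ)
    (fun z u => R.omega_rι₁ z g u a p)
    (fun z => by rw [Fock.harmCircle_apply_of_mem_hpiece R.kW₁ hp z, R.thetaLift₁_embH_smul]) (by omega)

/-- (Ported verbatim from the HodgeCMPerL package; no docstring in the source.) -/
theorem thetaLift₂_eq_zero_of_mem_hpiece (χ : D.X) (hχ : D.allowed χ) (a : R.Away₂) {k' : ℤ} {p : Fock.HarmModel}
    (hp : p ∈ Fock.hpiece k') (hk' : k' ≠ 1) (g : R.DS.G) :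
    R.DS.thetaLift₂ R.ν₂ (R.ch₂ χ) (R.embH₂ a p) g = 0 :=
  thetaLift₂_eq_zero_of_weight R.DS R.ν₂ (R.ch₂ χ) R.rι₂ (-(1 + R.kW₂)) (k' + R.kW₂) (R.embH₂ a p)
    (fun z => R.embH₂ a (Fock.harmCircle R.kW₂ z p)) g (fun z => R.period_rι₂ z _ g χ) (R.ch_rι₂ χ hχ)
    (fun z u => R.omega_rι₂ z g u a p)
    (fun z => by rw [Fock.harmCircle_apply_of_mem_hpiece R.kW₂ hp z, R.thetaLift₂_embH_smul]) (by omega)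

/-- … as elements of `C` -/
theorem thetaH₁_eq_zero_of_mem_hpiece (χ : D.X) (hχ : D.allowed χ) (a : R.Away₁) {k' : ℤ} {p : Fock.HarmModel}
    (hp : p ∈ Fock.hpiece k') (hk' : k' ≠ 1) : R.thetaH₁ χ a p = 0 := by
  apply R.evalC_injective
  funext g
  rw [R.evalC_thetaH₁, map_zero, Pi.zero_apply]
  exact R.thetaLift₁_eq_zero_of_mem_hpiece χ hχ a hp hk' g

/-- (Ported verbatim from the HodgeCMPerL package; no docstring in the source.) -/
theorem thetaH₂_eq_zero_of_mem_hpiece (χ : D.X) (hχ : D.allowed χ) (a : R.Away₂) {k' : ℤ} {p : Fock.HarmModel}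
    (hp : p ∈ Fock.hpiece k') (hk' : k' ≠ 1) : R.thetaH₂ χ a p = 0 := by
  apply R.evalC_injective
  funext g
  rw [R.evalC_thetaH₂, map_zero, Pi.zero_apply]
  exact R.thetaLift₂_eq_zero_of_mem_hpiece χ hχ a hp hk' g

/-- **ll. 362–364 away from `ι₁`, KERNEL:** a pure type with a non-vacuum `U(W_{j,b})`-weight at some real `b ≠ ι₁` (i.e.
NOT `U(3)_b`-invariant) lifts to `0` against every allowed character. -/
theorem thetaH₁_eq_zero_of_wt (χ : D.X) (hχ : D.allowed χ) (a : R.Away₁) (b : R.Pl) (hb : R.wt₁ b a ≠ -R.e₁ b) :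
    R.thetaH₁ χ a = 0 := by
  refine LinearMap.ext fun p => ?_
  apply R.evalC_injective
  funext g
  rw [R.evalC_thetaH₁, LinearMap.zero_apply, map_zero, Pi.zero_apply]
  exact thetaLift₁_eq_zero_of_weight R.DS R.ν₁ (R.ch₁ χ) (R.r₁ b) (R.e₁ b) (R.wt₁ b a) (R.embH₁ a p)
    (fun z => R.embH₁ a (((z : ℂ) ^ R.wt₁ b a) • p)) g (fun z => R.period_r₁ b z _ g χ) (R.ch_r₁ χ hχ b)
    (fun z u => R.omega_r₁ b z g u a p) (fun z => R.thetaLift₁_embH_smul χ a _ p g) hb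

/-- (Ported verbatim from the HodgeCMPerL package; no docstring in the source.) -/
theorem thetaH₂_eq_zero_of_wt (χ : D.X) (hχ : D.allowed χ) (a : R.Away₂) (b : R.Pl) (hb : R.wt₂ b a ≠ -R.e₂ b) :
    R.thetaH₂ χ a = 0 := by
  refine LinearMap.ext fun p => ?_
  apply R.evalC_injective
  funext g
  rw [R.evalC_thetaH₂, LinearMap.zero_apply, map_zero, Pi.zero_apply]
  exact thetaLift₂_eq_zero_of_weight R.DS R.ν₂ (R.ch₂ χ) (R.r₂ b) (R.e₂ b) (R.wt₂ b a) (R.embH₂ a p)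
    (fun z => R.embH₂ a (((z : ℂ) ^ R.wt₂ b a) • p)) g (fun z => R.period_r₂ b z _ g χ) (R.ch_r₂ χ hχ b)
    (fun z u => R.omega_r₂ b z g u a p) (fun z => R.thetaLift₂_embH_smul χ a _ p g) hb

/-- non-admissible away data lift to `0` -/
theorem thetaH₁_eq_zero_of_not_adm (χ : D.X) (hχ : D.allowed χ) (a : R.Away₁) (ha : ¬ R.Adm₁ a) :
    R.thetaH₁ χ a = 0 := by
  obtain ⟨b, hb⟩ := not_forall.mp ha
  exact R.thetaH₁_eq_zero_of_wt χ hχ a b hb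

/-- (Ported verbatim from the HodgeCMPerL package; no docstring in the source.) -/
theorem thetaH₂_eq_zero_of_not_adm (χ : D.X) (hχ : D.allowed χ) (a : R.Away₂) (ha : ¬ R.Adm₂ a) :
    R.thetaH₂ χ a = 0 := by
  obtain ⟨b, hb⟩ := not_forall.mp ha
  exact R.thetaH₂_eq_zero_of_wt χ hχ a b hb

/-- **`θ(p ⊗ a, χ′) = θ(projJ p ⊗ a, χ′)`, KERNEL:** only the `J⁺`-component of the Fock factor lifts. -/
theorem thetaH₁_apply_eq_thetaJ_projJ (χ : D.X) (hχ : D.allowed χ) (a : R.Away₁) (p : Fock.HarmModel) :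
    R.thetaH₁ χ a p = R.thetaJ₁ χ a (projJ p) :=
  apply_eq_apply_projJ (R.thetaH₁ χ a) (fun _ hk' _ hf => R.thetaH₁_eq_zero_of_mem_hpiece χ hχ a hf hk') p

/-- (Ported verbatim from the HodgeCMPerL package; no docstring in the source.) -/
theorem thetaH₂_apply_eq_thetaJ_projJ (χ : D.X) (hχ : D.allowed χ) (a : R.Away₂) (p : Fock.HarmModel) :
    R.thetaH₂ χ a p = R.thetaJ₂ χ a (projJ p) :=
  apply_eq_apply_projJ (R.thetaH₂ χ a) (fun _ hk' _ hf => R.thetaH₂_eq_zero_of_mem_hpiece χ hχ a hf hk') p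

/-- (eq:seesaw) on a finite sum of pure tensors of arbitrary pure types, evaluated (F3 `periodC_sum_tmul` widened). -/
theorem evalC_periodC_sum (χ : D.X) {ι : Type} (s : Finset ι) (a₁ : ι → R.Away₁) (a₂ : ι → R.Away₂)
    (p₁ p₂ : ι → Fock.HarmModel) (g : R.DS.G) :
    R.evalC (R.periodC χ (∑ i ∈ s, R.DS.tmul (R.embH₁ (a₁ i) (p₁ i)) (R.embH₂ (a₂ i) (p₂ i)))) g =
      ∑ i ∈ s, R.evalC (R.thetaH₁ χ (a₁ i) (p₁ i)) g * R.evalC (R.thetaH₂ χ (a₂ i) (p₂ i)) g := by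
  rw [R.evalC_periodC,
    thetaPeriod_sum_tmul R.DS R.ν₁ R.ν₂ R.omegaSub R.evSub R.evalTmul R.restrictTmul R.absSummable₁ R.absSummable₂
      (R.ch₁ χ) (R.ch₂ χ) s (fun i => R.embH₁ (a₁ i) (p₁ i)) (fun i => R.embH₂ (a₂ i) (p₂ i))
      (fun i _ g' => R.integrable₁ χ (a₁ i) (p₁ i) g') (fun i _ g' => R.integrable₂ χ (a₂ i) (p₂ i) g') g]
  refine Finset.sum_congr rfl fun i _ => ?_
  rw [R.evalC_thetaH₁, R.evalC_thetaH₂]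

/-- **F3's dictionary field `ϑ_pr` DERIVED** (ll. 362–364 discharged): for `Φ ∈ P`, `D.ϑ χ Φ = pr_κ ϑ_{T′,χ}(Φ″)` with
`Φ″ = Σ_i (projJ p₁ⁱ ⊗ a₁ⁱ) ⊗ (projJ p₂ⁱ ⊗ a₂ⁱ)` summed over the ADMISSIBLE indices only — the off-type terms of the given
expansion vanish in the kernel (`thetaH_eq_zero_of_not_adm`, `thetaH_apply_eq_thetaJ_projJ`). -/
theorem ϑ_pr_adm (χ : D.X) (hχ : D.allowed χ) (Φ : T.SK V c) (hΦ : Φ ∈ R.P) :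
    ∃ (n : ℕ) (a₁ : Fin n → R.Away₁) (a₂ : Fin n → R.Away₂) (p₁ p₂ : Fin n → jplusSubmodule),
      (∀ i, R.Adm₁ (a₁ i) ∧ R.Adm₂ (a₂ i)) ∧
        D.ϑ χ Φ = R.toHG (pr R.μ (pPlusMat.comp R.κ) R.σ
          (R.periodC χ (∑ i, R.DS.tmul (R.embH₁ (a₁ i) (p₁ i : Fock.HarmModel))
            (R.embH₂ (a₂ i) (p₂ i : Fock.HarmModel))))) := by
  classical
  obtain ⟨n, a₁, a₂, p₁, p₂, hϑ⟩ := R.ϑ_pr χ hχ Φ hΦ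
  let I : Finset (Fin n) := Finset.univ.filter fun i => R.Adm₁ (a₁ i) ∧ R.Adm₂ (a₂ i)
  let e : I ≃ Fin I.card := I.equivFin
  refine ⟨I.card, fun j => a₁ (e.symm j), fun j => a₂ (e.symm j), fun j => projJ (p₁ (e.symm j)),
    fun j => projJ (p₂ (e.symm j)), fun j => (Finset.mem_filter.mp (e.symm j).2).2, ?_⟩
  rw [hϑ]
  congr 2
  apply R.evalC_injective
  funext g
  rw [R.evalC_periodC_sum, R.evalC_periodC_sum]
  -- the summands, before and after projecting the `ι₁` factor to `J⁺`
  let t : Fin n → ℂ := fun i =>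
    R.evalC (R.thetaH₁ χ (a₁ i) (projJ (p₁ i) : Fock.HarmModel)) g *
      R.evalC (R.thetaH₂ χ (a₂ i) (projJ (p₂ i) : Fock.HarmModel)) g
  have ht : ∀ i, R.evalC (R.thetaH₁ χ (a₁ i) (p₁ i)) g * R.evalC (R.thetaH₂ χ (a₂ i) (p₂ i)) g = t i := fun i => by
    simp only [t, R.thetaH₁_apply_eq_thetaJ_projJ χ hχ (a₁ i) (p₁ i), R.thetaH₂_apply_eq_thetaJ_projJ χ hχ (a₂ i) (p₂ i),
      thetaJ₁_apply, thetaJ₂_apply]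
  have hzero : ∀ i ∈ (Finset.univ : Finset (Fin n)), i ∉ I →
      R.evalC (R.thetaH₁ χ (a₁ i) (p₁ i)) g * R.evalC (R.thetaH₂ χ (a₂ i) (p₂ i)) g = 0 := by
    intro i _ hi
    have hi' : ¬ (R.Adm₁ (a₁ i) ∧ R.Adm₂ (a₂ i)) := fun h => hi (Finset.mem_filter.mpr ⟨Finset.mem_univ i, h⟩)
    rcases not_and_or.mp hi' with h | h
    · rw [R.thetaH₁_eq_zero_of_not_adm χ hχ (a₁ i) h, LinearMap.zero_apply, map_zero, Pi.zero_apply, zero_mul]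
    · rw [R.thetaH₂_eq_zero_of_not_adm χ hχ (a₂ i) h, LinearMap.zero_apply, map_zero, Pi.zero_apply, mul_zero]
  calc ∑ i, R.evalC (R.thetaH₁ χ (a₁ i) (p₁ i)) g * R.evalC (R.thetaH₂ χ (a₂ i) (p₂ i)) g
      = ∑ i ∈ I, R.evalC (R.thetaH₁ χ (a₁ i) (p₁ i)) g * R.evalC (R.thetaH₂ χ (a₂ i) (p₂ i)) g :=
        (Finset.sum_subset (Finset.subset_univ I) hzero).symm
    _ = ∑ i ∈ I, t i := Finset.sum_congr rfl fun i _ => ht i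
    _ = ∑ x : I, t x := (Finset.sum_coe_sort I t).symm
    _ = ∑ j, t (e.symm j) := (e.symm.sum_comp fun x : I => t x).symm


-- port_pkg: scope closed for this part
end QautSeesawArchBridge
end QautSeesawArch
end PerL34
end HodgeCM
end
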